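import Summits.QuantumFields.YangMills.Theorems.UnitScaleTiltProp7DirichletOfGaussComb
import Summits.QuantumFields.YangMills.Theorems.UnitScaleTiltProp7PinnedCovSupRowT3
import Summits.QuantumFields.YangMills.Theorems.UnitScaleTiltProp7CovHodgeSplit
import Literature.MathematicalPhysics.QuantumFieldTheory.Balaban1983to89.T3ContinuumYM3Torus
import Summits.QuantumFields.YangMills.Theorems.UnitScaleTiltProp7CoclosedEnergiesOfHKgK
import HarnessLib

/-!
# Route `UnitScaleTilt`, crux K1 «MinimiserStabilityRegPr» (stmt-QuantumFields-19200), route-R E′ S3 K-form engine, row (P′) — «HXB′-KNIT»: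
# px5's displayed Gauss composite `hXb′` (✓p685828 `Prop7RowPOfCombFaceFluxRows.rowP_of_combFaceFluxRows`, against the COMB-DIRECT face functional) at the E′ member — run `K` of a T³ family,
# level `K − n`, `SU(2)` background `W`, `W̄ = ` the `(K−n)`-fold average — FOLLOWS from two displayed rows of the engine's standard type: hKg′-K(Gauss-fam) (the canonical corner (Kg′) family of
# the Gauss-comb local models, ✓p685629) and hVH (the near-face junction pairing, ✓p680975∕✓p684863), plus the co-closed split's mass (`Σ‖B‖² ≤ 2M`); pure-mass coefficient `4a⁻¹` free

Cell `ym3-torus`, width seat `ym3-torus-px15` (gen 3); ★ym-ust-19200-p1 g17 WORD 2 «px15: HXB′ DOOR — GO».  THEOREMS ONLY (0 `def`, 0 `sorry`, 0 `instance`); `--supports stmt-QuantumFields-19200`, count-neutral.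
YM₃ on T³ is a ladder rung (R3), not the Clay problem; nothing here claims a stub, the crux, d = 4 or the mass gap; hKg′-K(Gauss-fam) and hVH are DISPLAYED, not proved.

WHAT IS PROVED (ns `…Theorems.Prop7RowXbPrimeOfGaussFamRows`): `sigma_eq` (`V_k⁻¹·ℓ·L^(K−n) = ℓ⁻¹` at d = 3), `massHS_le` (`Σ_xΣ_μ|B⟨x,μ⟩|²_HS ≤ 2·Σ_b‖B b‖²`), ★★★ `hXb_prime_of_gaussFamRows` — with `Kr Mr e` FREE reals
(the assembler instantiates them with ✓p685828's sums), `a > 0` free: hKg′-K(Gauss-fam) `ℓ⁻¹·a·2·Σ_y FAM^{corner}_y ≤ ℓ·ζ_G·Kr + θ_G·e·ℓ⁻¹·Mr` ∧ hVH `ℓ⁻¹·2|Σ_y Re tr(φ₀(c_y)ᴴ·J_VH(y))| ≤ ℓ·ζ_V·Kr + θ_V·e·ℓ⁻¹·Mr` ∧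
`Σ_b‖B b‖² ≤ 2·Mr` ⟹ `2|Σ_c Re tr(D_cᴴ·FACE′_c)| ≤ ℓ·(ζ_G + ζ_V)·Kr + (4a⁻¹)·ℓ⁻¹·Mr + (θ_G + θ_V)·e·ℓ⁻¹·Mr` (px5's LHS VERBATIM; RHS in its five-slot shape with `ζ_X∕θ := ζ_G + ζ_V`, `θ := 4a⁻¹`,
`θ_X := θ_G + θ_V`, `C_X := η_X := 0`).
HONEST SCOPE.  Composition (✓p684863 ∘ ✓p685629 + HS∕op seams); the two displayed rows are the Gauss composite's analytic residue (commutator family at `IsCritR2` ∕ EML-COMM junction).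

References: T. Bałaban, CMP 102 (1985) 277–309 [Balaban1985Variational] ((135) p.298, Prop. 7 p.299); CMP 95 (1984) 17–40 [Balaban1984PropagatorsI] ((1.18)–(1.21) pp.20–21);
CMP 99 (1985) 389–434 [Balaban1985BackgroundPropagators] ((3.3)–(3.8) pp.390–392); CMP 98 (1985) 17–51 [Balaban1985Averaging] ((9) p.18, (19)–(20) p.21, p.24); CMP 102 (1985) 255–275 [Balaban1985UV3] ((27) p.263).
-/

set_option autoImplicit false

noncomputable section

open scoped BigOperators Matrix Matrix.Norms.L2Operator

namespace Summit.QuantumFields.YangMills.Theorems.Prop7RowXbPrimeOfGaussFamRows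

open Literature.MathematicalPhysics.QuantumFieldTheory.Balaban1983to89
open Literature.MathematicalPhysics.QuantumFieldTheory.Balaban1983to89.T3ContinuumYM3Torus
open Finset T4Continuum BlockAveraging AveragingRT ExpMeanLog BlockAveragingEMLLinearised BlockAveragingEMLLinearisedBackground
open B7Prop1Explicit (Letter treeWord hol)
open B7Prop2Explicit (unitaryUnits mem_unitaryUnits)
open B7Eq78Linearization (conjR)
open B9Eq39Adjoint (R covD divB)
open B9TorusCalculus (torusT)
open B10Eq27TorusAxialLog (holT axialT pull unitsField toUField suIncl unitsField_mem_unitaryUnits)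
open B15DeterminingSets (embIter)
open Summit.QuantumFields.YangMills.Theorems.Prop7CovariantCoercivity (sum_norm_sq_le_mul_opNorm_sq)
open Summit.QuantumFields.YangMills.Theorems.Prop7CovHodgeSplit (unitsField_toUField_mem_unitary)
open Summit.QuantumFields.YangMills.Theorems.Prop7FlatHolonomy (sitesPerDir_zero_eq_mul_pow)
open Summit.QuantumFields.YangMills.Theorems.Prop7PinnedCovSupRowT3 (level_le)
open Summit.QuantumFields.YangMills.Theorems.Prop7GaussCompositeSplit (two_mul_abs_gauss_pairing_allOffsets_le)
open Summit.QuantumFields.YangMills.Theorems.Prop7DirichletOfGaussComb (dirGaussHS_int_le_canonical)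

/-- The knit's scalar at d = 3: `V_k⁻¹·ℓ·L^(K−n) = ℓ⁻¹`, `ℓ = L^(K−n)`, `V_k = ℓ³`. [cite: Balaban1984PropagatorsI, (1.18) p.20] -/
theorem sigma_eq (F : T3Family) (K n : ℕ) :
    (((((F.P K).L : ℝ) ^ (K - n)) ^ (F.P K).d)⁻¹ * (((F.P K).L : ℝ) ^ (K - n)) * (((F.P K).L ^ (K - n) : ℕ) : ℝ)) = ((F.L : ℝ) ^ (K - n))⁻¹ := by
  have hd : (F.P K).d = 3 := rfl
  have hL : (F.P K).L = F.L := rfl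
  rw [hd, hL]
  push_cast
  have hℓ : (0 : ℝ) < (F.L : ℝ) ^ (K - n) := pow_pos (by exact_mod_cast F.hL.2.le.trans_lt' (by norm_num)) _
  field_simp

/-- The HS mass of a bond field read in `(μ, x)` letters is at most `2`× its op-norm mass (`M₂(ℂ)`: HS ≤ `N`·op², `N = 2`). [folklore] -/
theorem massHS_le (F : T3Family) (K : ℕ) (B : PBond (F.P K) 0 → Matrix (Fin 2) (Fin 2) ℂ) :
    ∑ x : Site (F.P K) 0, ∑ μ : Fin (F.P K).d, ∑ j : Fin 2, ∑ l : Fin 2, ‖B ⟨x, μ⟩ j l‖ ^ 2 ≤ 2 * ∑ b : PBond (F.P K) 0, ‖B b‖ ^ 2 := by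
  rw [B10StarCount.sum_pbond (fun b : PBond (F.P K) 0 => ‖B b‖ ^ 2), Finset.mul_sum]
  refine Finset.sum_le_sum fun x _ => ?_
  rw [Finset.mul_sum]
  refine Finset.sum_le_sum fun μ _ => ?_
  have := sum_norm_sq_le_mul_opNorm_sq (B ⟨x, μ⟩)
  simpa using this

/-- ★★★ **HXB′-KNIT**: px5's displayed Gauss composite (✓p685828, comb-direct `FACE′`) ⟸ hKg′-K(Gauss-fam) ∧ hVH ∧ the split's mass — `Kr Mr e` free reals, `a > 0` free (pure-mass coefficient `4a⁻¹`).
[cite: Balaban1985Variational, (135) p.298, Prop. 7 p.299; Balaban1984PropagatorsI, (1.18)-(1.21) pp.20-21; Balaban1985BackgroundPropagators, (3.3)-(3.8) pp.390-392; Balaban1985Averaging, (9) p.18, p.24] -/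
theorem hXb_prime_of_gaussFamRows (F : T3Family) (n K : ℕ) (hnK : n < K) (W : GaugeField (F.P K) 0 (Matrix.specialUnitaryGroup (Fin 2) ℂ))
    (φ₀ : Site (F.P K) 0 → Matrix (Fin 2) (Fin 2) ℂ) (B : PBond (F.P K) 0 → Matrix (Fin 2) (Fin 2) ℂ)
    (hBc : ∀ x : Site (F.P K) 0, divB (torusT (F.P K) 0) (fun κ z => unitsField (toUField W) ⟨z, κ⟩) (fun κ z => B ⟨z, κ⟩) x = 0)
    (s t : Fin (F.P K).d → List (Fin (F.P K).d)) (hsplit : ∀ μ, (List.finRange (F.P K).d).reverse = s μ ++ μ :: t μ) (hs : ∀ μ, μ ∉ s μ) (ht : ∀ μ, μ ∉ t μ)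
    {Kr Mr e a ζ_G θ_G ζ_V θ_V : ℝ} (ha : 0 < a) (hM : ∑ b : PBond (F.P K) 0, ‖B b‖ ^ 2 ≤ 2 * Mr)
    -- ▢ hKg′-K(Gauss-fam): the canonical corner (Kg′) family of the Gauss-comb local models, booked in K ∕ (eM) currency
    (hKgG : ((F.L : ℝ) ^ (K - n))⁻¹ * a * ((2 : ℝ) * ∑ y : Site (F.P K) (K - n), (Fintype.card Unit : ℝ)⁻¹ * ∑ _η : Unit, (2 * ∑ μ : Fin (F.P K).d, ((((t μ).length * (F.P K).L ^ (K - n) : ℕ) : ℝ) * ∑ i ∈ Finset.range (t μ).length, (((2 * (F.P K).L ^ (K - n) + 1) ^ ((t μ).length - i) : ℕ) : ℝ)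
          * ∑ q ∈ Fintype.piFinset (fun _ : Fin (F.P K).d => Finset.Icc (-(((F.P K).L ^ (K - n) : ℕ) : ℤ)) (((F.P K).L ^ (K - n) : ℕ) : ℤ)),
              (‖((hol (pull (unitsField (toUField W)) (Site.fibreSite 0 (K - n) y fun _ => ⟨0, pow_pos (F.P K).L_pos (K - n)⟩)) q [((t μ).getD i μ, true), (μ, true), Letter.rev ((t μ).getD i μ, true), (μ, false)] :
                      (Matrix (Fin 2) (Fin 2) ℂ)ˣ) : Matrix (Fin 2) (Fin 2) ℂ)
                    * R (hol (pull (unitsField (toUField W)) (Site.fibreSite 0 (K - n) y fun _ => ⟨0, pow_pos (F.P K).L_pos (K - n)⟩)) 0 (treeWord q))⁻¹ (R (Unitary.toUnits (suIncl (holAt W (walk (embIter (K - n) y) (treeWord fun _ : Fin (F.P K).d => -((((F.P K).L ^ (K - n) - 1) / 2 : ℕ) : ℤ))))))⁻¹ (φ₀ (embIter (K - n) y)))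
                  - R (hol (pull (unitsField (toUField W)) (Site.fibreSite 0 (K - n) y fun _ => ⟨0, pow_pos (F.P K).L_pos (K - n)⟩)) 0 (treeWord q))⁻¹ (R (Unitary.toUnits (suIncl (holAt W (walk (embIter (K - n) y) (treeWord fun _ : Fin (F.P K).d => -((((F.P K).L ^ (K - n) - 1) / 2 : ℕ) : ℤ))))))⁻¹ (φ₀ (embIter (K - n) y)))
                    * ((hol (pull (unitsField (toUField W)) (Site.fibreSite 0 (K - n) y fun _ => ⟨0, pow_pos (F.P K).L_pos (K - n)⟩)) q [((t μ).getD i μ, true), (μ, true), Letter.rev ((t μ).getD i μ, true), (μ, false)] :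
                      (Matrix (Fin 2) (Fin 2) ℂ)ˣ) : Matrix (Fin 2) (Fin 2) ℂ)‖ ^ 2
              + ‖((hol (pull (unitsField (toUField W)) (Site.fibreSite 0 (K - n) y fun _ => ⟨0, pow_pos (F.P K).L_pos (K - n)⟩)) q [((t μ).getD i μ, false), (μ, true), Letter.rev ((t μ).getD i μ, false), (μ, false)] :
                      (Matrix (Fin 2) (Fin 2) ℂ)ˣ) : Matrix (Fin 2) (Fin 2) ℂ)
                    * R (hol (pull (unitsField (toUField W)) (Site.fibreSite 0 (K - n) y fun _ => ⟨0, pow_pos (F.P K).L_pos (K - n)⟩)) 0 (treeWord q))⁻¹ (R (Unitary.toUnits (suIncl (holAt W (walk (embIter (K - n) y) (treeWord fun _ : Fin (F.P K).d => -((((F.P K).L ^ (K - n) - 1) / 2 : ℕ) : ℤ))))))⁻¹ (φ₀ (embIter (K - n) y)))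
                  - R (hol (pull (unitsField (toUField W)) (Site.fibreSite 0 (K - n) y fun _ => ⟨0, pow_pos (F.P K).L_pos (K - n)⟩)) 0 (treeWord q))⁻¹ (R (Unitary.toUnits (suIncl (holAt W (walk (embIter (K - n) y) (treeWord fun _ : Fin (F.P K).d => -((((F.P K).L ^ (K - n) - 1) / 2 : ℕ) : ℤ))))))⁻¹ (φ₀ (embIter (K - n) y)))
                    * ((hol (pull (unitsField (toUField W)) (Site.fibreSite 0 (K - n) y fun _ => ⟨0, pow_pos (F.P K).L_pos (K - n)⟩)) q [((t μ).getD i μ, false), (μ, true), Letter.rev ((t μ).getD i μ, false), (μ, false)] :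
                      (Matrix (Fin 2) (Fin 2) ℂ)ˣ) : Matrix (Fin 2) (Fin 2) ℂ)‖ ^ 2)))) ≤ ((F.L : ℝ) ^ (K - n)) * ζ_G * Kr + θ_G * e * ((F.L : ℝ) ^ (K - n))⁻¹ * Mr)
    -- ▢ hVH: the near-face junction pairing (EML-COMM), booked in K ∕ (eM) currency
    (hVH : ((F.L : ℝ) ^ (K - n))⁻¹ * (2 * |∑ y : Site (F.P K) (K - n), (((φ₀ (embIter (K - n) y))ᴴ * ∑ μ : Fin (F.P K).d, ∑ r ∈ univ.filter (fun r : Fin (F.P K).d → Fin ((F.P K).L ^ (K - n)) => (r μ : ℕ) + 1 = (F.P K).L ^ (K - n)),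
              (R (Unitary.toUnits (suIncl (holAt W (walk (embIter (K - n) y) (treeWord fun _ : Fin (F.P K).d => -((((F.P K).L ^ (K - n) - 1) / 2 : ℕ) : ℤ))))) * axialT (unitsField (toUField W)) (Site.fibreSite 0 (K - n) y fun _ => ⟨0, pow_pos (F.P K).L_pos (K - n)⟩) (Site.fibreSite 0 (K - n) y (Function.update r μ ⟨0, pow_pos (F.P K).L_pos (K - n)⟩))
                    * (unitsField (toUField W) ⟨Site.fibreSite 0 (K - n) (y.unshift μ) r, μ⟩)⁻¹) (B ⟨Site.fibreSite 0 (K - n) (y.unshift μ) r, μ⟩)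
                - R ((unitsField (toUField (Averaging.iter (fun i => blockAvg (P := F.P K) (j := i) (expMeanLogSU (n := Fin 2))) (K - n) W)) ⟨y.unshift μ, μ⟩)⁻¹ * (Unitary.toUnits (suIncl (holAt W (walk (embIter (K - n) (y.unshift μ)) (treeWord fun _ : Fin (F.P K).d => -((((F.P K).L ^ (K - n) - 1) / 2 : ℕ) : ℤ))))) * axialT (unitsField (toUField W)) (Site.fibreSite 0 (K - n) (y.unshift μ) fun _ => ⟨0, pow_pos (F.P K).L_pos (K - n)⟩) (Site.fibreSite 0 (K - n) (y.unshift μ) r)))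
                    (B ⟨Site.fibreSite 0 (K - n) (y.unshift μ) r, μ⟩))).trace).re|) ≤ ((F.L : ℝ) ^ (K - n)) * ζ_V * Kr + θ_V * e * ((F.L : ℝ) ^ (K - n))⁻¹ * Mr) :
    2 * |∑ c : PBond (F.P K) (K - n), (((φ₀ (embIter (K - n) c.src) - ((Averaging.iter (fun i => blockAvg (P := F.P K) (j := i) (expMeanLogSU (n := Fin 2))) (K - n) W c : Matrix.specialUnitaryGroup (Fin 2) ℂ) : Matrix (Fin 2) (Fin 2) ℂ) * φ₀ (embIter (K - n) c.tgt) * star ((Averaging.iter (fun i => blockAvg (P := F.P K) (j := i) (expMeanLogSU (n := Fin 2))) (K - n) W c : Matrix.specialUnitaryGroup (Fin 2) ℂ) : Matrix (Fin 2) (Fin 2) ℂ))ᴴ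
        * (((((F.P K).L : ℝ) ^ (K - n)) ^ (F.P K).d)⁻¹ • (((holAt W (walk (embIter (K - n) c.src) (treeWord fun _ : Fin (F.P K).d => -((((F.P K).L ^ (K - n) - 1) / 2 : ℕ) : ℤ))) : Matrix.specialUnitaryGroup (Fin 2) ℂ) : Matrix (Fin 2) (Fin 2) ℂ) * ((((F.P K).L : ℝ) ^ (K - n)) • ∑ r : Fin (F.P K).d → Fin ((F.P K).L ^ (K - n)),
            conjR (holT (unitsField (toUField W)) (Site.fibreSite 0 (K - n) c.src fun _ => ⟨0, pow_pos (F.P K).L_pos (K - n)⟩)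
                (treeWord fun ν => ((Function.update r c.dir ⟨(F.P K).L ^ (K - n) - 1, Nat.sub_lt (pow_pos (F.P K).L_pos (K - n)) one_pos⟩ ν : ℕ) : ℤ)))
              (B ⟨(fun z : Site (F.P K) 0 => z.shift c.dir)^[(F.P K).L ^ (K - n) - 1 - (r c.dir : ℕ)] (Site.fibreSite 0 (K - n) c.src r), c.dir⟩)) * star ((holAt W (walk (embIter (K - n) c.src) (treeWord fun _ : Fin (F.P K).d => -((((F.P K).L ^ (K - n) - 1) / 2 : ℕ) : ℤ))) : Matrix.specialUnitaryGroup (Fin 2) ℂ) : Matrix (Fin 2) (Fin 2) ℂ)))).trace).re|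
      ≤ ((F.L : ℝ) ^ (K - n)) * (ζ_G + ζ_V) * Kr + (4 * a⁻¹) * ((F.L : ℝ) ^ (K - n))⁻¹ * Mr + (θ_G + θ_V) * e * ((F.L : ℝ) ^ (K - n))⁻¹ * Mr := by
  classical
  have hk : K - n ≤ (F.P K).m + (F.P K).K := level_le F K n
  have hk1 : 1 ≤ K - n := by omega
  have h : (F.P K).sitesPerDir 0 = (F.P K).L ^ (K - n) * (F.P K).sitesPerDir (K - n) := by rw [sitesPerDir_zero_eq_mul_pow hk, mul_comm]
  have hV : ∀ b, unitsField (toUField W) b ∈ unitaryUnits (Matrix (Fin 2) (Fin 2) ℂ) := fun b => unitsField_mem_unitaryUnits (toUField W) b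
  have hWc : ∀ c : PBond (F.P K) (K - n), ((unitsField (toUField (Averaging.iter (fun i => blockAvg (P := F.P K) (j := i) (expMeanLogSU (n := Fin 2))) (K - n) W)) c :
      (Matrix (Fin 2) (Fin 2) ℂ)ˣ) : Matrix (Fin 2) (Fin 2) ℂ) ∈ unitary (Matrix (Fin 2) (Fin 2) ℂ) := fun c => unitsField_toUField_mem_unitary _ c.dir c.src
  have hg : ∀ y : Site (F.P K) (K - n), ((Unitary.toUnits (suIncl (holAt W (walk (embIter (K - n) y)
      (treeWord fun _ : Fin (F.P K).d => -((((F.P K).L ^ (K - n) - 1) / 2 : ℕ) : ℤ))))) : (Matrix (Fin 2) (Fin 2) ℂ)ˣ) : Matrix (Fin 2) (Fin 2) ℂ)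
      ∈ unitary (Matrix (Fin 2) (Fin 2) ℂ) := fun y => (suIncl _).2
  -- the door (✓p684863) at these letters
  have hdoor := two_mul_abs_gauss_pairing_allOffsets_le hk h hV hWc hg (fun y => φ₀ (embIter (K - n) y)) (fun κ z => B ⟨z, κ⟩) hBc ha
  -- the scalar, the Dirichlet family, the mass
  have hσ := sigma_eq F K n
  have hDIR := dirGaussHS_int_le_canonical hk hk1 h hV
    (fun y => Unitary.toUnits (suIncl (holAt W (walk (embIter (K - n) y) (treeWord fun _ : Fin (F.P K).d => -((((F.P K).L ^ (K - n) - 1) / 2 : ℕ) : ℤ))))))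
    (fun y => φ₀ (embIter (K - n) y)) s t hsplit hs ht
  have hmass := massHS_le F K B
  have hℓ : (0 : ℝ) < (F.L : ℝ) ^ (K - n) := pow_pos (by exact_mod_cast F.hL.2.le.trans_lt' (by norm_num)) _
  have hℓi : (0 : ℝ) ≤ ((F.L : ℝ) ^ (K - n))⁻¹ := (inv_pos.mpr hℓ).le
  rw [hσ] at hdoor
  -- read the door's coercions in px5's letters (`↑(unitsField (toUField W̄) c) = ↑(W̄ c)`, `↑(toUnits (suIncl g)) = ↑g`, both `rfl`) and beta-reduce
  have e1 : ∀ c : PBond (F.P K) (K - n), ((unitsField (toUField (Averaging.iter (fun i => blockAvg (P := F.P K) (j := i) (expMeanLogSU (n := Fin 2))) (K - n) W)) c :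
      (Matrix (Fin 2) (Fin 2) ℂ)ˣ) : Matrix (Fin 2) (Fin 2) ℂ)
      = ((Averaging.iter (fun i => blockAvg (P := F.P K) (j := i) (expMeanLogSU (n := Fin 2))) (K - n) W c : Matrix.specialUnitaryGroup (Fin 2) ℂ) : Matrix (Fin 2) (Fin 2) ℂ) :=
    fun c => rfl
  have e2 : ∀ y : Site (F.P K) (K - n), ((Unitary.toUnits (suIncl (holAt W (walk (embIter (K - n) y)
      (treeWord fun _ : Fin (F.P K).d => -((((F.P K).L ^ (K - n) - 1) / 2 : ℕ) : ℤ))))) : (Matrix (Fin 2) (Fin 2) ℂ)ˣ) : Matrix (Fin 2) (Fin 2) ℂ)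
      = ((holAt W (walk (embIter (K - n) y) (treeWord fun _ : Fin (F.P K).d => -((((F.P K).L ^ (K - n) - 1) / 2 : ℕ) : ℤ))) : Matrix.specialUnitaryGroup (Fin 2) ℂ) :
          Matrix (Fin 2) (Fin 2) ℂ) := fun y => rfl
  simp only [e1, e2] at hdoor
  -- bookkeeping
  have h1 : ((F.L : ℝ) ^ (K - n))⁻¹ * (a * ∑ y : Site (F.P K) (K - n), ∑ μ : Fin (F.P K).d, ∑ r ∈ univ.filter (fun r : Fin (F.P K).d → Fin ((F.P K).L ^ (K - n)) => (r μ : ℕ) + 1 < (F.P K).L ^ (K - n)),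
              ∑ j : Fin 2, ∑ l : Fin 2, ‖(covD (torusT (F.P K) 0) (fun κ z => unitsField (toUField W) ⟨z, κ⟩) μ
                (fun z => R (Unitary.toUnits (suIncl (holAt W (walk (embIter (K - n) y) (treeWord fun _ : Fin (F.P K).d => -((((F.P K).L ^ (K - n) - 1) / 2 : ℕ) : ℤ))))) * axialT (unitsField (toUField W)) (Site.fibreSite 0 (K - n) y fun _ => ⟨0, pow_pos (F.P K).L_pos (K - n)⟩) z)⁻¹ (φ₀ (embIter (K - n) y))) (Site.fibreSite 0 (K - n) y r)) j l‖ ^ 2) ≤ ((F.L : ℝ) ^ (K - n)) * ζ_G * Kr + θ_G * e * ((F.L : ℝ) ^ (K - n))⁻¹ * Mr := by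
    refine le_trans ?_ hKgG
    have := mul_le_mul_of_nonneg_left hDIR (mul_nonneg hℓi ha.le)
    simpa only [mul_assoc, Nat.cast_ofNat] using this
  have h2 : ((F.L : ℝ) ^ (K - n))⁻¹ * (a⁻¹ * ∑ x : Site (F.P K) 0, ∑ μ : Fin (F.P K).d, ∑ j : Fin 2, ∑ l : Fin 2, ‖B ⟨x, μ⟩ j l‖ ^ 2) ≤ (4 * a⁻¹) * ((F.L : ℝ) ^ (K - n))⁻¹ * Mr := by
    have hai : 0 ≤ a⁻¹ := (inv_pos.mpr ha).le
    have := mul_le_mul_of_nonneg_left (hmass.trans (mul_le_mul_of_nonneg_left hM (by norm_num))) (mul_nonneg hℓi hai)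
    nlinarith [this]
  have hsum : ((F.L : ℝ) ^ (K - n))⁻¹ * (a * ∑ y : Site (F.P K) (K - n), ∑ μ : Fin (F.P K).d, ∑ r ∈ univ.filter (fun r : Fin (F.P K).d → Fin ((F.P K).L ^ (K - n)) => (r μ : ℕ) + 1 < (F.P K).L ^ (K - n)),
              ∑ j : Fin 2, ∑ l : Fin 2, ‖(covD (torusT (F.P K) 0) (fun κ z => unitsField (toUField W) ⟨z, κ⟩) μ
                (fun z => R (Unitary.toUnits (suIncl (holAt W (walk (embIter (K - n) y) (treeWord fun _ : Fin (F.P K).d => -((((F.P K).L ^ (K - n) - 1) / 2 : ℕ) : ℤ))))) * axialT (unitsField (toUField W)) (Site.fibreSite 0 (K - n) y fun _ => ⟨0, pow_pos (F.P K).L_pos (K - n)⟩) z)⁻¹ (φ₀ (embIter (K - n) y))) (Site.fibreSite 0 (K - n) y r)) j l‖ ^ 2 + a⁻¹ * ∑ x : Site (F.P K) 0, ∑ μ : Fin (F.P K).d, ∑ j : Fin 2, ∑ l : Fin 2, ‖B ⟨x, μ⟩ j l‖ ^ 2 + 2 * |∑ y : Site (F.P K) (K - n), (((φ₀ (embIter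 (K - n) y))ᴴ * ∑ μ : Fin (F.P K).d, ∑ r ∈ univ.filter (fun r : Fin (F.P K).d → Fin ((F.P K).L ^ (K - n)) => (r μ : ℕ) + 1 = (F.P K).L ^ (K - n)),
              (R (Unitary.toUnits (suIncl (holAt W (walk (embIter (K - n) y) (treeWord fun _ : Fin (F.P K).d => -((((F.P K).L ^ (K - n) - 1) / 2 : ℕ) : ℤ))))) * axialT (unitsField (toUField W)) (Site.fibreSite 0 (K - n) y fun _ => ⟨0, pow_pos (F.P K).L_pos (K - n)⟩) (Site.fibreSite 0 (K - n) y (Function.update r μ ⟨0, pow_pos (F.P K).L_pos (K - n)⟩))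
                    * (unitsField (toUField W) ⟨Site.fibreSite 0 (K - n) (y.unshift μ) r, μ⟩)⁻¹) (B ⟨Site.fibreSite 0 (K - n) (y.unshift μ) r, μ⟩)
                - R ((unitsField (toUField (Averaging.iter (fun i => blockAvg (P := F.P K) (j := i) (expMeanLogSU (n := Fin 2))) (K - n) W)) ⟨y.unshift μ, μ⟩)⁻¹ * (Unitary.toUnits (suIncl (holAt W (walk (embIter (K - n) (y.unshift μ)) (treeWord fun _ : Fin (F.P K).d => -((((F.P K).L ^ (K - n) - 1) / 2 : ℕ) : ℤ))))) * axialT (unitsField (toUField W)) (Site.fibreSite 0 (K - n) (y.unshift μ) fun _ => ⟨0, pow_pos (F.P K).L_pos (K - n)⟩) (Site.fibreSite 0 (K - n) (y.unshift μ) r)))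
                    (B ⟨Site.fibreSite 0 (K - n) (y.unshift μ) r, μ⟩))).trace).re|)
      = ((F.L : ℝ) ^ (K - n))⁻¹ * (a * ∑ y : Site (F.P K) (K - n), ∑ μ : Fin (F.P K).d, ∑ r ∈ univ.filter (fun r : Fin (F.P K).d → Fin ((F.P K).L ^ (K - n)) => (r μ : ℕ) + 1 < (F.P K).L ^ (K - n)),
              ∑ j : Fin 2, ∑ l : Fin 2, ‖(covD (torusT (F.P K) 0) (fun κ z => unitsField (toUField W) ⟨z, κ⟩) μ
                (fun z => R (Unitary.toUnits (suIncl (holAt W (walk (embIter (K - n) y) (treeWord fun _ : Fin (F.P K).d => -((((F.P K).L ^ (K - n) - 1) / 2 : ℕ) : ℤ))))) * axialT (unitsField (toUField W)) (Site.fibreSite 0 (K - n) y fun _ => ⟨0, pow_pos (F.P K).L_pos (K - n)⟩) z)⁻¹ (φ₀ (embIter (K - n) y))) (Site.fibreSite 0 (K - n) y r)) j l‖ ^ 2) + ((F.L : ℝ) ^ (K - n))⁻¹ * (a⁻¹ * ∑ x : Site (F.P K) 0, ∑ μ : Fin (F.P K).d, ∑ j : Fin 2, ∑ l : Fin 2,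 ‖B ⟨x, μ⟩ j l‖ ^ 2) + ((F.L : ℝ) ^ (K - n))⁻¹ * (2 * |∑ y : Site (F.P K) (K - n), (((φ₀ (embIter (K - n) y))ᴴ * ∑ μ : Fin (F.P K).d, ∑ r ∈ univ.filter (fun r : Fin (F.P K).d → Fin ((F.P K).L ^ (K - n)) => (r μ : ℕ) + 1 = (F.P K).L ^ (K - n)),
              (R (Unitary.toUnits (suIncl (holAt W (walk (embIter (K - n) y) (treeWord fun _ : Fin (F.P K).d => -((((F.P K).L ^ (K - n) - 1) / 2 : ℕ) : ℤ))))) * axialT (unitsField (toUField W)) (Site.fibreSite 0 (K - n) y fun _ => ⟨0, pow_pos (F.P K).L_pos (K - n)⟩) (Site.fibreSite 0 (K - n) y (Function.update r μ ⟨0, pow_pos (F.P K).L_pos (K - n)⟩))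
                    * (unitsField (toUField W) ⟨Site.fibreSite 0 (K - n) (y.unshift μ) r, μ⟩)⁻¹) (B ⟨Site.fibreSite 0 (K - n) (y.unshift μ) r, μ⟩)
                - R ((unitsField (toUField (Averaging.iter (fun i => blockAvg (P := F.P K) (j := i) (expMeanLogSU (n := Fin 2))) (K - n) W)) ⟨y.unshift μ, μ⟩)⁻¹ * (Unitary.toUnits (suIncl (holAt W (walk (embIter (K - n) (y.unshift μ)) (treeWord fun _ : Fin (F.P K).d => -((((F.P K).L ^ (K - n) - 1) / 2 : ℕ) : ℤ))))) * axialT (unitsField (toUField W)) (Site.fibreSite 0 (K - n) (y.unshift μ) fun _ => ⟨0, pow_pos (F.P K).L_pos (K - n)⟩) (Site.fibreSite 0 (K - n) (y.unshift μ) r)))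
                    (B ⟨Site.fibreSite 0 (K - n) (y.unshift μ) r, μ⟩))).trace).re|) := by
    ring
  rw [hsum] at hdoor
  linarith [hdoor, h1, h2, hVH]

end Summit.QuantumFields.YangMills.Theorems.Prop7RowXbPrimeOfGaussFamRows

end
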